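import Summits.Schanuel.Schanuel.Theorems.RootDecomp1KParamThueMahler02

/-!
# RootDecomp1KParamThueMahler — lens 1, generation 56, NODE 17 «SIEGEL GENUS 0 ON THE K-LINE (Thue–Mahler on the parameter line)» (RULE K-R47 payable clause; CLAIM L2669, PRICE L2670, VERDICT L2680, K-R48) — continuation (RootDecomp1KParamThueMahler03): §3 (end) the showcase member Q17 = Qa 3

(lens-1 g56 NODE 17 HOME kernel K2 = HOME/decomp-schanuel-lens-1/g56/ParamThueMahler.lean 6128daf4…, 642 l, 87 thm + 8 def, imports tree …RootDecomp1KThueMahler04 ONLY = the port of node 16 (no Literature import, no fact def, no private / set_option); Probe / Ctrl0 / Ctrl + NODE-g56b.md + presearch_g56b.txt + SHA256SUMS; CLAIM L2669, crit EX-ANTE PRICE L2670 (ONE THEOREM ×1 under K-R47's payable clause «an infinite class of RE-AMENDED-FRONTIER pairs of x-degree ≥ 2 made unconditional … by a record input provably reaching where the record could not» iff CHECKLIST K-g56b; RULE K-R48 pre-announced), lens INFO L2671, NODE L2677, critic VERDICT L2680: CLEARED — THEOREM ×1 under K-R47's payable clause (EX-ANTE PRICE L2670), CHECKLIST K-g56b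 (1)–(10) MET, with ONE POST-HOC CONDITION OF RECORD (census files the LIVENESS rows «node17 Q17 / Qa 0 / Qa 1», key xParamTM, reading «rate 1 / exp ½ ⇒ FRONTIER at m₀ = 2, not x-linear, not killed» — FILED as census/LIVENESS-v7 e94537bf…/9b531c72…, INSTRUMENT NOTE 7 L2683: the rows read exactly so); RULE K-R48 FIXED (toolkit of record ∪= rational-uniformisation transfer (`XParamTM` shape, `param_of_point`) feeding `finite_dyadicPts`; FRONTIER re-amended by «NOT XParamTM-level-finite»; open territory of record at m₀ = 2 := re-amended-frontier pairs of x-degree ≥ 2 that are NOT XParamTM — positive-genus rate-1 members, standing witness M17P; UNCONDITIONAL PART := DecidedAt ∨ MachineDecidedAt ∨ LocalAt ∨ GaussAt ∨ XLinTM ∨ XParamTM); PORT GO (K2 verbatim; docstrings/provenance only; «cite-token» spelling; dedup 0; identity diff + tree farm by the successor critic crit-1 g10). Port by census-1 gen 22 as `RootDecomp1KParamThueMahler01–03` (`--supports stmt-Schanuel-33364`; no census credit): 01 = §1 the x-UNIFORMISED CLASS **`XParamTM P`** (∃ U V ∈ ℤ[t], V ℚ-separable, 3 ≤ deg V, deg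 U ≤ deg V, U ⊥ V, ∃ E : Finset ℚ, ∀ C, ∃ C', every bounded non-degenerate rational point (x, r), x ∈ ℚ, has r ∈ E or x = U(t)/V(t) for some |t| ≤ C' with V(t) ≠ 0) and THEOREM A **`levelFinite_of_xParamTM : XParamTM P → LevelFinite P`**, `thinFibreAt_of_xParamTM` (every m₀), `xParamTM_of_xLinTM`, bridge `dyadicPt_of_level_param` into node 16's `finite_dyadicPts` + §2 THE SQUARE-ROOT UNIFORMISED CURVES `sqrtParamP U₀ U₁ V₀ V₁ = (U₀(Y) − x·V₀(Y))² − Y·(x·V₁(Y) − U₁(Y))²`, `twist`, `excR`, `param_of_point`, THEOREM B **`xParamTM_sqrtParamP`**, `levelFinite_sqrtParamP`, `thinFibreAt_sqrtParamP`; 02 = §3 the INFINITE x-DEGREE-2 FAMILY **`Qa a := sqrtParamP (C a) 1 (X² + C 2) 1`** (U = t + a, V = t⁴ + t + 2; common top Y⁴ + 4Y² − Y + 4): `xParamTM_Qa`, `levelFinite_Qa`, **`thinFibreAt_Qa (a) (m₀)` HYP-FREE**, the x-presentation `Qa_eq_xPolyP` / `qC` and the UNIFORM territory certificates `not_decidedAt_two_Qa`,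 `not_localAt_Qa`, `not_gaussAt_Qa`, `not_heightDecidedAt_two_Qa`, `not_xLinTM_Qa`, `Qa_ne_twoTermP`, `Qa_ne_normShapeCurve`, `sepTopAt_two_Qa`, `Qa_injective`, **`Qa_territory`**; 03 = the showcase member **`Q17 = Qa 3 = x²(Y⁴ + 4Y² − Y + 4) − 2x(3Y² − Y + 6) + (9 − Y)`**: `thinFibreAt_Q17_all`, `Q17_territory`, `natDegree_Qa_eq_two_mul_xdeg` (the machine cap as an equality). PORT EDITS: 45 one-line docstrings on undocumented computation lemmas (statements quoted); otherwise none (no dedup twin: K2's `abs_le_of_sq_le` is a different statement from `RootDecomp1KLevelFinite.abs_le_of_sq_le` and resolves in K2's own namespace exactly as in the lens's farm run; no private, no set_option, no cite-token in a def docstring); provenance doc blocks + continuation headers = K2's own open-lines; statements and proofs VERBATIM. Rung 0 — nothing here proves Schanuel, 33364, 33363, 31077 or ThinFibre 2; the class, the family and the member are HYPOTHESIS-FREE; M17P (positive genus) does not move.)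
-/

noncomputable section

namespace Summit.Schanuel.Schanuel.Theorems.RootDecomp1KParamThueMahler

open Polynomial LiouvilleNumber
open scoped Nat
open Summit.Schanuel.Schanuel.Theorems.RootDecomp1KTwoBaseCell (psNumer)
open Summit.Schanuel.Schanuel.Theorems.RootDecomp1KDegreeLadder
open Summit.Schanuel.Schanuel.Theorems.RootDecomp1KXLinear
open Summit.Schanuel.Schanuel.Theorems.RootDecomp1KXLinearII
open Summit.Schanuel.Schanuel.Theorems.RootDecomp1KXAll
open Summit.Schanuel.Schanuel.Theorems.RootDecomp1KLevelFinite
open Summit.Schanuel.Schanuel.Theorems.RootDecomp1KSubspaceBranch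
open Summit.Schanuel.Schanuel.Theorems.RootDecomp1KXTop
open Summit.Schanuel.Schanuel.Theorems.RootDecomp1KLocalExponent
open Summit.Schanuel.Schanuel.Theorems.RootDecomp1KIntegrality
open Summit.Schanuel.Schanuel.Theorems.RootDecomp1KHeightGrading
open Summit.Schanuel.Schanuel.Theorems.RootDecomp1KHeightMachine
open Summit.Schanuel.Schanuel.Theorems.RootDecomp1KRelLiouvilleCell (partialSum_two_strictMono)
open Summit.Schanuel.Schanuel.Theorems.RootDecomp1KThueMahler

/-- the showcase member **`Q17 := sqrtParamP (C 3) 1 (Y² + 2) 1 = (3 − x(Y² + 2))² − Y(x − 1)²`**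
`= x²(Y⁴ + 4Y² − Y + 4) − 2x(3Y² − Y + 6) + (9 − Y)` (`= Qa 3`). -/
def Q17 : ℤ[X][X] := sqrtParamP (C 3) 1 (X ^ 2 + C 2) 1

/-- `Q17 = Qa 3` (by `rfl`). -/
theorem Q17_eq_Qa : Q17 = Qa 3 := rfl

/-- its `x`-coefficients, read back: `[9 − Y; −2(3Y² − Y + 6); Y⁴ + 4Y² − Y + 4]`. -/
def q17C : ℕ → ℤ[X] := fun j =>
  if j = 2 then X ^ 4 + C 4 * X ^ 2 - X + C 4 else if j = 1 then -(C 2 * (C 3 * X ^ 2 - X + C 6)) else C 9 - X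

/-- `q17C 2 = X ^ 4 + C 4 * X ^ 2 - X + C 4`. -/
theorem q17C_two : q17C 2 = X ^ 4 + C 4 * X ^ 2 - X + C 4 := by simp [q17C]
/-- `q17C 1 = -(C 2 * (C 3 * X ^ 2 - X + C 6))`. -/
theorem q17C_one : q17C 1 = -(C 2 * (C 3 * X ^ 2 - X + C 6)) := by simp [q17C]
/-- `q17C 0 = C 9 - X`. -/
theorem q17C_zero : q17C 0 = C 9 - X := by simp [q17C]

/-- `q17C = qC 3`. -/
theorem q17C_eq_qC : q17C = qC 3 := by
  funext j
  by_cases h2 : j = 2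
  · subst h2; rw [q17C_two, qC_two]
  by_cases h1 : j = 1
  · subst h1; rw [q17C_one, qC_one]; simp only [map_mul, map_ofNat]; ring
  · rw [show q17C j = C 9 - X by simp [q17C, h2, h1], show qC 3 j = C (3 ^ 2) - X by simp [qC, h2, h1]]; norm_num

/-- the `x`-presentation `Q17 = xPolyP 2 q17C`. -/
theorem Q17_eq_xPolyP : Q17 = xPolyP 2 q17C := by rw [q17C_eq_qC]; exact Qa_eq_xPolyP 3

/-- `bev Q17 x y = (9 - y) + x * (-(2 * (3 * y ^ 2 - y + 6))) + x ^ 2 * (y ^ 4 + 4 * y ^ 2 - y + 4)`. -/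
theorem bev_Q17 (x y : ℝ) : bev Q17 x y = (9 - y) + x * (-(2 * (3 * y ^ 2 - y + 6))) + x ^ 2 * (y ^ 4 + 4 * y ^ 2 - y + 4) := by
  rw [Q17_eq_Qa, bev_Qa]; push_cast; ring

/-- `XParamTM Q17` (the member is in the x-uniformised class). -/
theorem xParamTM_Q17 : XParamTM Q17 := xParamTM_Qa 3

/-- `LevelFinite Q17`, HYPOTHESIS-FREE. -/
theorem levelFinite_Q17 : LevelFinite Q17 := levelFinite_Qa 3

/-- **`ThinFibreAt m₀ Q17` for EVERY `m₀`, hypothesis-free** (in particular at `m₀ = 2`). -/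
theorem thinFibreAt_Q17_all (m₀ : ℕ) : ThinFibreAt m₀ Q17 := thinFibreAt_Qa 3 m₀

/-- `ThinFibreAt 2 Q17`, HYPOTHESIS-FREE (the re-amended-frontier value `m₀ = 2`). -/
theorem thinFibreAt_two_Q17 : ThinFibreAt 2 Q17 := thinFibreAt_Qa 3 2

/-- THE CAP of node 12/13's height machine, typed: `deg_Y Q17 = 2·xdeg Q17` — the strict inequality `deg_Y < m₀·xdeg`
of `HeightDecidedAt 2` is an EQUALITY on the whole family (likewise `deg φ = 4 = 2·deg ψ` for the uniformisation
`(x, y) = (U(t)/V(t), t²)`, so `ParamAt 2`/`CorrAt 2` are not available by the machine's own degree count; the tree has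
no composition-degree lemma to refute `MachineDecidedAt 2` by name — cap STATED, not refuted). -/
theorem natDegree_Qa_eq_two_mul_xdeg (a : ℤ) : (Qa a).natDegree = 2 * xdeg (Qa a) := by
  rw [natDegree_Qa, xdeg_Qa]

/-- `¬ XLinearLt Q17` (territory certificate). -/
theorem not_xLinearLt_Q17 : ¬ XLinearLt Q17 := not_xLinearLt_Qa 3
/-- `¬ XLinTM Q17` (x-degree `2`: outside node 16's x-linear Thue–Mahler class). -/
theorem not_xLinTM_Q17 : ¬ XLinTM Q17 := not_xLinTM_Qa 3
/-- `Q17 ≠ xLinP A B` for all `A B`. -/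
theorem Q17_ne_xLinP (A B : ℤ[X]) : Q17 ≠ xLinP A B := Qa_ne_xLinP 3 A B
/-- `Q17 ≠ twoTermP k B A` for all `k B A`. -/
theorem Q17_ne_twoTermP (k : ℕ) (B A : ℤ[X]) : Q17 ≠ twoTermP k B A := Qa_ne_twoTermP 3 k B A
/-- `¬ DecidedAt 2 Q17` (territory certificate at `m₀ = 2`). -/
theorem not_decidedAt_two_Q17 : ¬ DecidedAt 2 Q17 := not_decidedAt_two_Qa 3
/-- `¬ LocalAt 2 Q17` (territory certificate: irrational simple `ℚ₂`-root of the top, `m₀ ≤ 2`). -/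
theorem not_localAt_two_Q17 : ¬ LocalAt 2 Q17 := not_localAt_Qa 3 le_rfl
/-- `¬ GaussAt 2 Q17` (territory certificate: `deg_Y c₀ = 1 < deg_Y c₂ = 4`). -/
theorem not_gaussAt_two_Q17 : ¬ GaussAt 2 Q17 := not_gaussAt_Qa 3 2
/-- `¬ HeightDecidedAt 2 Q17` (territory certificate at `m₀ = 2`). -/
theorem not_heightDecidedAt_two_Q17 : ¬ HeightDecidedAt 2 Q17 := not_heightDecidedAt_two_Qa 3
/-- HONESTY: `Q17` IS in node 11's class — decided there CONDITIONALLY on `PadicSubspace` (as `M17P`); node 17 decides it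
hypothesis-free. -/
theorem sepTopAt_two_Q17 : SepTopAt 2 Q17 := sepTopAt_two_Qa 3
/-- the top `topX Q17 = Y⁴ + 4Y² − Y + 4` has no rational root: `aeval q (topX Q17) ≠ 0` for `q : ℚ`. -/
theorem aeval_q17top_ne_zero_rat (q : ℚ) : aeval q (topX Q17) ≠ 0 := by
  rw [Q17_eq_Qa, topX_Qa]; exact aeval_qC_two_ne_zero_rat 3 q
/-- the top of `Q17` has a `ℚ₂`-root: `∃ z : ℚ_[2], aeval z (topX Q17) = 0` (Hensel). -/
theorem exists_padic_root_q17top : ∃ z : ℚ_[2], aeval z (topX Q17) = 0 := by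
  rw [Q17_eq_Qa, topX_Qa]; exact exists_padic_root_qC_two 3

/-- **`Q17_territory`** — in NO class decided at `m₀ = 2` in the tree (by tree names), yet level-finite and thin at
every `m₀`, hypothesis-free. -/
theorem Q17_territory : ¬ DecidedAt 2 Q17 ∧ ¬ LocalAt 2 Q17 ∧ ¬ GaussAt 2 Q17 ∧ ¬ HeightDecidedAt 2 Q17 ∧ ¬ XLinTM Q17 ∧
    ¬ XLinearLt Q17 ∧ (∀ A B, Q17 ≠ xLinP A B) ∧ (∀ k B A, Q17 ≠ twoTermP k B A) ∧
    (∀ g q n D, Q17 ≠ normShapeCurve g q n D) ∧ 3 ≤ thinThreshold Q17 ∧ SepTopAt 2 Q17 ∧ LevelFinite Q17 ∧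
    ∀ m₀, ThinFibreAt m₀ Q17 :=
  ⟨not_decidedAt_two_Qa 3, not_localAt_Qa 3 le_rfl, not_gaussAt_Qa 3 2, not_heightDecidedAt_two_Qa 3, not_xLinTM_Qa 3,
    not_xLinearLt_Qa 3, Qa_ne_xLinP 3, Qa_ne_twoTermP 3, Qa_ne_normShapeCurve 3, three_le_thinThreshold _,
    sepTopAt_two_Qa 3, levelFinite_Qa 3, thinFibreAt_Qa 3⟩

/-- the members are pairwise distinct (`c₀ = a² − Y` … no: `c₁` carries `a` linearly): `a ↦ Qa a` is injective. -/
theorem Qa_injective : Function.Injective Qa := by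
  intro a b h
  have h1 := congrArg (fun P : ℤ[X][X] => (P.coeff 0).coeff 1) h
  simp only [Qa_eq_xPolyP, coeff_coeff_xPolyP] at h1
  rw [if_pos (by simp), if_pos (by simp), qC_one, qC_one] at h1
  simp [coeff_X] at h1
  linarith

end Summit.Schanuel.Schanuel.Theorems.RootDecomp1KParamThueMahler

end
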